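import Literature.NumberTheory.LFunctions.FordExpSumMidLambda
import Literature.NumberTheory.LFunctions.FordZetaBound748
import Literature.NumberTheory.LFunctions.FordLargeLambda2
import Literature.NumberTheory.LFunctions.FordLargeLambdaTail2
import Literature.NumberTheory.LFunctions.FordTheorem3Rows
import Literature.NumberTheory.LFunctions.FordIncompleteTheorem4
import HarnessLib

/-!
# Discharge of `zero_bound_large_height_mossinghoff_trudgian_yang` (and of `zeta_bound_ford`)

Topic `Literature/NumberTheory/LFunctions`. Pure proof file (three theorems, no `def`), sibling of
`VinogradovKorobov.lean` where both named facts are stated.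

* `FordVK.expSum_bound_lambda_ge_87_uncond` — **Ford's Theorem 2 for `t ≥ N^{87}`, unconditionally,
  with constant `10.031`** (`B = 1/133.66`): the certified §5 rows (`FordLargeLambda2.lean`, constant
  `10.031 = 1.06 · 9.463`) and the tail `λ ≥ 2025` (`FordLargeLambdaTail2.lean`), fed with the tree's
  theorems — the rows of [Ford2002, (1.7)] for `129 ≤ k ≤ 1190` at `θ' = 2.4191 / 2.3856 / 2.3296`
  (`FordP1.theorem3_row_*'`, `FordTheorem3Rows.lean`: PROGRAM 1 of the source by kernel
  certificates, Lemma 3.4 proved in `FordLemma34.lean`), the row `k ≥ 1191` with the printed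
  constants (`FordP1.row_ge_1191`, Lemma 3.6 of the source), and Theorem 4 in the library form
  `FordVK.ford_theorem4_lib` (`FordIncompleteTheorem4.lean`, §4 of the source).
* `zeta_bound_ford_holds` — **Ford's Theorem 1** (`|ζ(σ+it)| ≤ 76.2 t^{4.45(1−σ)^{3/2}} log^{2/3} t`),
  by `zeta_bound_ford_of_exp_sum_bound13_lambda_gt_87` (`FordExpSumMidLambda.lean`: the rows
  `8 ≤ λ ≤ 87` of Table 1 certified, §§6–7 of the source with the constant `13 ≥ 10.031`).
* `zero_bound_large_height_mossinghoff_trudgian_yang_holds` — **[MTY2024, Lemma 5.2 / (5.5)]**: every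
  zero `β + it` of `ζ` with `t ≥ e^{52238}` has
  `(1 − β) B^{2/3} (log t)^{2/3} (log log t)^{1/3} ≥ 0.048976` (`B = 4.45`), by
  `zero_bound_large_height_of_exp_sum_bound13_large_lambda` (`FordZetaBound748.lean`: Ford's
  Theorem 1 with `A = 74.8` from Theorem 2 with any constant `≤ 13`, then §5 of [MTY2024] as
  formalised in `VinogradovKorobovLargeHeight*.lean`).

## References
* K. Ford, *Vinogradov's integral and bounds for the Riemann zeta function*, Proc. London Math.
  Soc. (3) 85 (2002), 565–633; arXiv:1910.08209: Theorems 1–4, (1.7), §§3–7. [Ford2002]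
* M. J. Mossinghoff, T. S. Trudgian, A. Yang, *Explicit zero-free regions for the Riemann
  zeta-function*, Res. Number Theory 10 (2024), no. 1, Paper No. 11; arXiv:2212.06867: Lemma 5.2,
  (5.5), Table 2. [MossinghoffTrudgianYangRNT2024]
-/

open Finset Real

namespace Literature.NumberTheory.LFunctions

namespace FordVK

/-- **Ford's Theorem 2 for `t ≥ N^{87}`, unconditional, constant `10.031`**: for
`1 ≤ N < R₀ ≤ 2N`, `0 < u ≤ 1`, `t ≥ N^{87}`,
`‖∑_{N<n≤R₀} (n+u)^{-it}‖ ≤ 10.031 · N^{1 − (log N)²/(133.66 (log t)²)}`.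
[cite: Ford2002, Theorem 2 (with `10.031` for `9.463`), §5, Lemmas 5.2–5.3] -/
theorem expSum_bound_lambda_ge_87_uncond {N R₀ : ℕ} {t u : ℝ} (hN : 1 ≤ N) (hNR : N < R₀)
    (hR : R₀ ≤ 2 * N) (hu0 : 0 < u) (hu1 : u ≤ 1) (ht1 : (N : ℝ) ^ (87 : ℕ) ≤ t) :
    ‖∑ n ∈ Ioc N R₀, ((n : ℂ) + u) ^ (-(t * Complex.I))‖
      ≤ 10.031 * (N : ℝ) ^ (1 - Real.log N ^ 2 / (133.66 * Real.log t ^ 2)) := by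
  rcases le_or_gt t ((N : ℝ) ^ (2025 : ℕ)) with h | h
  · exact expSum_bound_lambda_87_2025' FordP1.theorem3_row_ge_200' FordP1.theorem3_row_150_199'
      FordP1.theorem3_row_129_149' ford_theorem4_lib hN hNR hR hu0 hu1 ht1 h
  · exact Tail.expSum_bound_lambda_ge_2025_v2' (fun k hk => FordP1.row_ge_1191 hk) ford_theorem4_lib
      hN hNR hR hu0 hu1 h.le

end FordVK

/-- **Ford's Theorem 1** [Ford2002, Theorem 1]: `|ζ(σ+it)| ≤ 76.2 t^{4.45(1−σ)^{3/2}} log^{2/3} t`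
(`1/2 ≤ σ ≤ 1`, `t ≥ 3`) — the named fact `zeta_bound_ford` holds. [cite: Ford2002, Theorem 1, §7] -/
theorem zeta_bound_ford_holds : zeta_bound_ford :=
  zeta_bound_ford_of_exp_sum_bound13_lambda_gt_87 fun _N _R _t _u hN hNt hu0 hu1 hNR hR =>
    (FordVK.expSum_bound_lambda_ge_87_uncond hN hNR hR hu0 hu1 hNt).trans
      (mul_le_mul_of_nonneg_right (by norm_num) (by positivity))

/-- **[MTY2024, Lemma 5.2 with (5.5)]: the large-height Vinogradov–Korobov zero bound** — every zero
`β + it` of `ζ` with `t ≥ T₀ = e^{52238}` satisfies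
`(1 − β) · B^{2/3} (log t)^{2/3} (log log t)^{1/3} ≥ M₁ = 0.048976` (`B = 4.45`): the named fact
`zero_bound_large_height_mossinghoff_trudgian_yang` holds.
[cite: MossinghoffTrudgianYangRNT2024, Lemma 5.2, (5.5), Table 2; Ford2002, Theorems 1–2] -/
theorem zero_bound_large_height_mossinghoff_trudgian_yang_holds :
    zero_bound_large_height_mossinghoff_trudgian_yang :=
  zero_bound_large_height_of_exp_sum_bound13_large_lambda fun N R t u hN hNt hu0 hu1 hNR hR => by
    rcases le_or_gt t ((N : ℝ) ^ 87) with h87 | h87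
    · have hN1 : (1 : ℝ) ≤ N := by exact_mod_cast hN
      have hNt' : (N : ℝ) ≤ t := le_trans (by
        calc (N : ℝ) = (N : ℝ) ^ 1 := (pow_one _).symm
          _ ≤ (N : ℝ) ^ 8 := pow_le_pow_right₀ hN1 (by norm_num)) hNt
      exact FordVK.expSum_bound_mid_lambda N R t u hN hNt' h87 hu0 hu1 hNR hR
    · exact (FordVK.expSum_bound_lambda_ge_87_uncond hN hNR hR hu0 hu1 h87.le).trans
        (mul_le_mul_of_nonneg_right (by norm_num) (by positivity))

end Literature.NumberTheory.LFunctions
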